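import Mathlib
import HarnessLib
import Summits.HubbardSuperconductivity.HubbardSuperconductivity.Theorems.KLProgrammeKLRegimeTwoPointAssemblyLimitDefs
import Literature.MathematicalPhysics.QuantumLattice.MatsubaraTruncationMidpoint
import Literature.Probability.LatticeModels.BrillouinRiemannSum
import Literature.Probability.LatticeModels.TorusCentredLift

/-!
# Child 4 `KLRegimeTwoPointAssemblyV7` (stmt-HubbardSuperconductivity-19666), stub `stub_asm_free`: the FREE part of the
# representation has an iterated limit — Matsubara tadpole at fixed `L`, then torus Riemann sums (seat hubbard-kl-r2d-p2)

`reprFree L M β μ K σ σ' x̄ ȳ = −δ_{σσ'} L⁻² Σ_{k⃗} e^{ip_{k⃗}·(x̄−ȳ)} · (1/β) Σ_ω ĝ_K(ω, k⃗)`.  As `M → ∞` the symmetric Matsubara sum of the free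
propagator is the midpoint tadpole `½ − n_F(e_K(k⃗))` (`tendsto_truncatedTadpole_bgm`), so at fixed `L ≥ 3`
`reprFree → fM L := −δ (2π)⁻² cornerRiemannSum (q ↦ G(q + π)) L`, `G(p) = e^{ip·(x−y)} (½ − n_F(ε(p) − μ − K(p)))` (for lattice
sites the torus phase is the integer phase); and `fM L → F := −δ (2π)⁻² ∫_{[−π,π]²} G(q + π) dq` by `tendsto_cornerRiemannSum`
(continuity of `G`).  BGM 2006 (2.3)–(2.4) at `U = 0` in the frame `K`.
-/

noncomputable section

namespace Summit.HubbardSuperconductivity.HubbardSuperconductivity.Theorems.TwoPointAssembly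

set_option linter.dupNamespace false -- summit = problem name (single-conjunct summit), D-0017

open Finset Filter Topology MeasureTheory Literature.MathematicalPhysics.QuantumLattice Literature.Probability.LatticeModels
open GrassmannAlgebra

/-! ## §1 The continuum integrand -/

/-- The midpoint tadpole `t_β(ξ) = ½ − (1 + e^{βξ})⁻¹ = ½ − n_F(ξ)`. -/
def tadpoleMid (β ξ : ℝ) : ℝ := 1 / 2 - (1 + Real.exp (β * ξ))⁻¹

/-- The continuum renormalised band `e_K(p) = −2(cos p₁ + cos p₂) − μ − K(p)` on `ℝ²`. -/
def bandCT (μ : ℝ) (K : TrigPolyC4v) (p : Fin 2 → ℝ) : ℝ := -2 * ∑ i, Real.cos (p i) - μ - K.eval p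

/-- The free equal-time integrand `G(p) = e^{ip·(x−y)} t_β(e_K(p))`. -/
def freeIntegrandCT (β μ : ℝ) (K : TrigPolyC4v) (z : Site 2) (p : Fin 2 → ℝ) : ℂ :=
  Complex.exp (Complex.I * ((∑ i, p i * (z i : ℝ) : ℝ) : ℂ)) * (tadpoleMid β (bandCT μ K p) : ℂ)

/-- Continuity of the frame's evaluation map. -/
theorem TrigPolyC4v.continuous_eval (K : TrigPolyC4v) : Continuous fun p : Fin 2 → ℝ => K.eval p := by
  simp only [TrigPolyC4v.eval_def, TrigPolyC4v.harmonic]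
  fun_prop

/-- Continuity of the continuum band. -/
theorem continuous_bandCT (μ : ℝ) (K : TrigPolyC4v) : Continuous (bandCT μ K) := by
  unfold bandCT
  have := TrigPolyC4v.continuous_eval K
  fun_prop

/-- Continuity of the midpoint tadpole. -/
theorem continuous_tadpoleMid (β : ℝ) : Continuous (tadpoleMid β) := by
  unfold tadpoleMid
  refine continuous_const.sub ((continuous_const.add (Real.continuous_exp.comp (continuous_const.mul continuous_id))).inv₀
    fun ξ => ?_)
  exact (by positivity : (0 : ℝ) < 1 + Real.exp (β * (id ξ))).ne'

/-- Continuity of the free integrand. -/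
theorem continuous_freeIntegrandCT (β μ : ℝ) (K : TrigPolyC4v) (z : Site 2) : Continuous (freeIntegrandCT β μ K z) := by
  unfold freeIntegrandCT
  have h1 : Continuous fun p : Fin 2 → ℝ => ((∑ i, p i * (z i : ℝ) : ℝ) : ℂ) :=
    Complex.continuous_ofReal.comp (by fun_prop)
  have h2 : Continuous fun p : Fin 2 → ℝ => ((tadpoleMid β (bandCT μ K p) : ℝ) : ℂ) :=
    Complex.continuous_ofReal.comp ((continuous_tadpoleMid β).comp (continuous_bandCT μ K))
  exact (Complex.continuous_exp.comp (continuous_const.mul h1)).mul h2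

/-! ## §2 The torus objects on the grid -/

variable {L : ℕ} [NeZero L]

omit [NeZero L] in
/-- The renormalised band on the torus is the continuum band at the lattice momentum. -/
theorem nambuXiCT_eq_bandCT (μ : ℝ) (K : TrigPolyC4v) (k : TorusSite 2 L) :
    nambuXiCT L μ K k = bandCT μ K (latticeMomentum L k) := by
  simp [nambuXiCT, torusBand, bandCT]

/-- For lattice sites the torus phase is the integer phase: `e^{ip_{k⃗}·(x̄−ȳ)} = e^{ip_{k⃗}·(x−y)}`. -/
theorem sitePhase_proj (k : TorusSite 2 L) (x y : Site 2) :
    sitePhase L k (Torus.proj L x) (Torus.proj L y) =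
      Complex.exp (Complex.I * ((∑ i, latticeMomentum L k i * ((x - y) i : ℝ) : ℝ) : ℂ)) := by
  rw [sitePhase]
  apply Complex.exp_eq_exp_iff_exists_int.mpr
  -- each coordinate representative differs from the integer one by a multiple of `L`
  have hrep : ∀ (w : Site 2) (i : Fin 2), ∃ m : ℤ, (((Torus.proj L w i).val : ℕ) : ℂ) = (w i : ℂ) + (L : ℂ) * (m : ℂ) := by
    intro w i
    refine ⟨-(w i / L), ?_⟩
    have h1 : (((Torus.proj L w i).val : ℕ) : ℤ) = w i % L := by
      rw [Torus.proj_apply, ZMod.val_intCast]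
    have h2 := Int.emod_add_mul_ediv (w i) L
    have h3 : (((Torus.proj L w i).val : ℕ) : ℤ) = w i + L * (-(w i / L)) := by rw [h1]; linarith
    have h4 := congrArg (fun z : ℤ => (z : ℂ)) h3
    push_cast at h4 ⊢
    exact h4
  choose mx hmx using hrep x
  choose my hmy using hrep y
  refine ⟨∑ i, ((k i).val : ℤ) * (mx i - my i), ?_⟩
  have hLr : (L : ℂ) ≠ 0 := by exact_mod_cast NeZero.ne L
  push_cast
  simp only [latticeMomentum, Pi.sub_apply, Fin.sum_univ_two, Int.cast_sub]
  push_cast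
  rw [hmx 0, hmx 1, hmy 0, hmy 1]
  field_simp
  ring

omit [NeZero L] in
/-- The Matsubara sum of the frame propagator at fixed `k⃗` converges to the midpoint tadpole. -/
theorem tendsto_matsubaraSum_propCT {β : ℝ} (hβ : 0 < β) (μ : ℝ) (K : TrigPolyC4v) (k : TorusSite 2 L) :
    Tendsto (fun M : ℕ => (1 / (β : ℂ)) * ∑ ω : MatsubaraIdx M, propCT L M β μ K (ω, k)) atTop
      (𝓝 ((tadpoleMid β (nambuXiCT L μ K k) : ℝ) : ℂ)) := by
  have h := tendsto_truncatedTadpole_bgm hβ (nambuXiCT L μ K k)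
  rw [tadpoleMid]
  refine h.congr fun M => ?_
  congr 1
  refine Finset.sum_congr rfl fun ω _ => ?_
  rw [propCT, neg_mul]

/-- The `M`-limit of the free part at fixed `L`: `−δ (2π)⁻² cornerRiemannSum (G(· + π)) L`. -/
def freeLimitM (β μ : ℝ) (K : TrigPolyC4v) (σ σ' : Fin 2) (x y : Site 2) (L : ℕ) : ℂ :=
  if σ = σ' then
    -((((2 * Real.pi) ^ 2 : ℝ) : ℂ)⁻¹ * cornerRiemannSum (fun q => freeIntegrandCT β μ K (x - y) (q + fun _ => Real.pi)) L)
  else 0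

/-- The free part as an `L⁻²`-average of site phases times Matsubara sums. -/
theorem reprFree_eq_sum (M : ℕ) {β : ℝ} (hβ : β ≠ 0) (μ : ℝ) (K : TrigPolyC4v) (σ : Fin 2) (xe ye : TorusSite 2 L) :
    reprFree L M β μ K σ σ xe ye =
      -((((L : ℝ) ^ 2 : ℝ) : ℂ)⁻¹ * ∑ k : TorusSite 2 L, sitePhase L k xe ye *
        ((1 / (β : ℂ)) * ∑ ω : MatsubaraIdx M, propCT L M β μ K (ω, k))) := by
  rw [reprFree, if_pos rfl, Fintype.sum_prod_type_right, neg_div, neg_inj, div_eq_inv_mul, Finset.mul_sum, Finset.mul_sum]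
  have hL : ((L : ℝ) : ℂ) ≠ 0 := by exact_mod_cast NeZero.ne L
  have hβ' : (β : ℂ) ≠ 0 := by exact_mod_cast hβ
  refine Finset.sum_congr rfl fun k _ => ?_
  rw [Finset.mul_sum, Finset.mul_sum, Finset.mul_sum, Finset.mul_sum]
  refine Finset.sum_congr rfl fun ω _ => ?_
  push_cast
  field_simp

/-- The grid average is the corner Riemann sum: `L⁻² Σ_{k⃗} G(p_{k⃗}) = (2π)⁻² cornerRiemannSum (G(·+π)) L`. -/
theorem avg_eq_cornerRiemannSum (G : (Fin 2 → ℝ) → ℂ) :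
    (((L : ℝ) ^ 2 : ℝ) : ℂ)⁻¹ * ∑ k : TorusSite 2 L, G (latticeMomentum L k) =
      (((2 * Real.pi) ^ 2 : ℝ) : ℂ)⁻¹ * cornerRiemannSum (fun q => G (q + fun _ => Real.pi)) L := by
  rw [cornerRiemannSum_eq]
  simp only [latticeMomentum_eq_cellCorner_add, Complex.real_smul, Finset.mul_sum]
  refine Finset.sum_congr rfl fun k _ => ?_
  have hL0 : (L : ℂ) ≠ 0 := by exact_mod_cast (NeZero.ne L)
  have hπ : (Real.pi : ℂ) ≠ 0 := by exact_mod_cast Real.pi_ne_zero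
  simp only [gridStep]
  push_cast
  field_simp

/-! ## §3 The stub -/

/-- **`stub_asm_free`** (registered signature of the V7-cut skeleton on stmt-HubbardSuperconductivity-19666). -/
theorem stub_asm_free : ∀ (β : ℝ), 0 < β → ∀ (μ : ℝ) (K : TrigPolyC4v) (σ σ' : Fin 2) (x y : Site 2),
    ∃ fM : ℕ → ℂ, ∃ F : ℂ,
      (∀ (L : ℕ) [NeZero L], 3 ≤ L →
        Tendsto (fun M : ℕ => reprFree L M β μ K σ σ' (Torus.proj L x) (Torus.proj L y)) atTop (𝓝 (fM L))) ∧
      Tendsto fM atTop (𝓝 F) := by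
  intro β hβ μ K σ σ' x y
  by_cases hσ : σ = σ'
  · subst hσ
    refine ⟨freeLimitM β μ K σ σ x y,
      -((((2 * Real.pi) ^ 2 : ℝ) : ℂ)⁻¹ * ∫ q in brillouin 2, freeIntegrandCT β μ K (x - y) (q + fun _ => Real.pi)), ?_, ?_⟩
    · intro L _ hL
      have hlim : Tendsto (fun M : ℕ => reprFree L M β μ K σ σ (Torus.proj L x) (Torus.proj L y)) atTop
          (𝓝 (-((((L : ℝ) ^ 2 : ℝ) : ℂ)⁻¹ * ∑ k : TorusSite 2 L, sitePhase L k (Torus.proj L x) (Torus.proj L y) *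
            ((tadpoleMid β (nambuXiCT L μ K k) : ℝ) : ℂ)))) := by
        simp only [reprFree_eq_sum _ hβ.ne']
        exact ((tendsto_finsetSum _ fun k _ => (tendsto_matsubaraSum_propCT hβ μ K k).const_mul _).const_mul _).neg
      convert hlim using 2
      rw [freeLimitM, if_pos rfl, ← avg_eq_cornerRiemannSum]
      congr 2
      refine Finset.sum_congr rfl fun k _ => ?_
      rw [freeIntegrandCT, sitePhase_proj, nambuXiCT_eq_bandCT]
    · have hf : freeLimitM β μ K σ σ x y = fun L =>
          -((((2 * Real.pi) ^ 2 : ℝ) : ℂ)⁻¹ * cornerRiemannSum (fun q => freeIntegrandCT β μ K (x - y) (q + fun _ => Real.pi)) L) := by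
        funext L; rw [freeLimitM, if_pos rfl]
      rw [hf]
      exact (Tendsto.const_mul _ (tendsto_cornerRiemannSum
        (((continuous_freeIntegrandCT β μ K (x - y)).comp (continuous_id.add continuous_const)).continuousOn))).neg
  · refine ⟨fun _ => 0, 0, fun L _ _ => ?_, tendsto_const_nhds⟩
    have h0 : (fun M : ℕ => reprFree L M β μ K σ σ' (Torus.proj L x) (Torus.proj L y)) = fun _ => 0 :=
      funext fun M => reprFree_of_ne L M β μ K hσ _ _
    rw [h0]
    exact tendsto_const_nhds

end Summit.HubbardSuperconductivity.HubbardSuperconductivity.Theorems.TwoPointAssembly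

end
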